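import Summits.Ventures.HodgeRepro2.T6B1Carriers
import Summits.Ventures.HodgeRepro2.T5HilbertSymbolNorm
import Summits.Ventures.HodgeRepro2.T4RealPlace

/-!
# The Hilbert symbol at the places of a number field — seat t6-p4's carriers read through files 133 / 14,
the parity count, and the real places (cell pub-hodge-repro2, seat p3)

Tier-5 N2 support, row N2.8.1 (ii) of route/T5-N2-route-3.md («by Hilbert reciprocity ∏_v (c, θ/v) = 1 (O'Meara
71:18)»). The DISPLAY of 71:18 is seat t6-p4's accepted `T6.Hyp.OMeara1963_71_18 K` (quote-audited, file T6B1Hyp),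
stated on the carriers `T6.B1Carriers.hilbertFin K v α β` / `hilbertInf K w α β` (O'Meara's §63B symbol on the
completions). This file makes those carriers usable by the consumer (`T5HermitianGlobalChain`):

* `hilbertFin_eq_one_iff`: `(α, β)_v = 1` iff file 133's `HilbertSolvable` holds on `K_v` (the same §63B equation);
* `hilbertFin_eq_neg_one_iff`: `(α, β)_v = −1` iff `(α, β)_v ≠ 1`;
* `finprod_hilbertFin_eq_neg_one_pow`: a finitely supported family of signs has product `(−1)^{#support}` — the
  parity count behind «the number of bad places is even»;
* `ringEquivReal_algebraMap`, `hilbertInf_eq_one_of_pos`: at a real place `w`, the symbol `(α, β)_w` is `1` as soon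
  as `α > 0` under the real embedding of `w` (file 14's real solvability, transported through Mathlib's
  `Completion.ringEquivRealOfIsReal`).

Mathlib + t6-p4's T6B1Carriers + this seat's files 133 / 14; no display; no device.
§8(d): uses an L-value-free non-vanishing device: NO.
-/

namespace Summit.Ventures.HodgeRepro2.T5HilbertSymbolPlaces

open IsDedekindDomain IsDedekindDomain.HeightOneSpectrum NumberField NumberField.InfinitePlace
open Summit.Ventures.HodgeRepro2.T6.B1Carriers Summit.Ventures.HodgeRepro2.T5HilbertSymbolNorm
  Summit.Ventures.HodgeRepro2.T4RealPlace

/-- `−1 ≠ 1` in `ℤˣ`. -/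
theorem neg_one_ne_one_intUnits : (-1 : ℤˣ) ≠ 1 := fun h => by simpa using congrArg Units.val h

section Symbol

variable {L : Type*} [Field L]

/-- Seat t6-p4's §63B clause and file 133's are the same equation. -/
theorem hilbertEqnSolvable_iff (α β : L) : HilbertEqnSolvable L α β ↔ HilbertSolvable α β := Iff.rfl

/-- `hilbertSymbol = 1` iff the §63B equation is solvable. -/
theorem hilbertSymbol_eq_one_iff (α β : L) : hilbertSymbol L α β = 1 ↔ HilbertSolvable α β := by
  unfold hilbertSymbol
  split_ifs with h
  · exact iff_of_true rfl h
  · exact iff_of_false neg_one_ne_one_intUnits h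

/-- `hilbertSymbol = −1` iff `hilbertSymbol ≠ 1`. -/
theorem hilbertSymbol_eq_neg_one_iff (α β : L) : hilbertSymbol L α β = -1 ↔ hilbertSymbol L α β ≠ 1 := by
  rcases Int.units_eq_one_or (hilbertSymbol L α β) with h | h <;> rw [h]
  · exact iff_of_false neg_one_ne_one_intUnits.symm (not_not.mpr rfl)
  · exact iff_of_true rfl neg_one_ne_one_intUnits

end Symbol

section Places

variable (F : Type*) [Field F] [NumberField F]

/-- `(α, β)_v = 1` iff `α ξ² + β η² = 1` is solvable in `F_v` (file 133's `HilbertSolvable`). -/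
theorem hilbertFin_eq_one_iff (v : HeightOneSpectrum (𝓞 F)) (α β : F) :
    hilbertFin F v α β = 1 ↔
      HilbertSolvable (algebraMap F (v.adicCompletion F) α) (algebraMap F (v.adicCompletion F) β) :=
  hilbertSymbol_eq_one_iff _ _

/-- `(α, β)_v = −1` iff `(α, β)_v ≠ 1`. -/
theorem hilbertFin_eq_neg_one_iff (v : HeightOneSpectrum (𝓞 F)) (α β : F) :
    hilbertFin F v α β = -1 ↔ hilbertFin F v α β ≠ 1 :=
  hilbertSymbol_eq_neg_one_iff _ _

/-- **The parity count:** a finitely supported family of signs has product `(−1)^{#support}`. -/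
theorem finprod_hilbertFin_eq_neg_one_pow (α β : F)
    (hfin : (Function.mulSupport fun v : HeightOneSpectrum (𝓞 F) => hilbertFin F v α β).Finite) :
    ∏ᶠ v : HeightOneSpectrum (𝓞 F), hilbertFin F v α β =
      (-1) ^ (Function.mulSupport fun v : HeightOneSpectrum (𝓞 F) => hilbertFin F v α β).ncard := by
  rw [finprod_eq_prod_of_mulSupport_subset _ (s := hfin.toFinset) hfin.coe_toFinset.symm.subset,
    Set.ncard_eq_toFinset_card _ hfin]
  refine Finset.prod_eq_pow_card fun v hv => ?_
  rw [Set.Finite.mem_toFinset, Function.mem_mulSupport] at hv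
  exact (hilbertFin_eq_neg_one_iff F v α β).mpr hv

omit [NumberField F] in
/-- The real completion at a real place reads an element of `F` through the real embedding of the place. -/
theorem ringEquivReal_algebraMap {w : InfinitePlace F} (hw : w.IsReal) (x : F) :
    Completion.ringEquivRealOfIsReal hw (algebraMap F w.Completion x) = embedding_of_isReal hw x := by
  simp

omit [NumberField F] in
/-- **At a real place `w`, `(α, β)_w = 1` as soon as `α > 0` under the real embedding of `w`** (file 14's
`ξ = 1/√α`, `η = 0`, transported to `F_w ≃ ℝ`). -/
theorem hilbertInf_eq_one_of_pos {w : InfinitePlace F} (hw : w.IsReal) {α : F}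
    (hα : 0 < embedding_of_isReal hw α) (β : F) : hilbertInf F w α β = 1 := by
  rw [hilbertInf, hilbertSymbol_eq_one_iff]
  obtain ⟨ξ, η, h⟩ := realHilbertSolvable_of_pos_left (embedding_of_isReal hw β) hα
  refine ⟨(Completion.ringEquivRealOfIsReal hw).symm ξ, (Completion.ringEquivRealOfIsReal hw).symm η, ?_⟩
  apply (Completion.ringEquivRealOfIsReal hw).injective
  rw [map_add, map_mul, map_mul, map_pow, map_pow, map_one, RingEquiv.apply_symm_apply,
    RingEquiv.apply_symm_apply, ringEquivReal_algebraMap, ringEquivReal_algebraMap]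
  exact h

end Places

end Summit.Ventures.HodgeRepro2.T5HilbertSymbolPlaces
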